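import Literature.AlgebraicGeometry.Frobenioids.ArchimedeanData
import Mathlib.Analysis.Complex.Basic
import Mathlib.Topology.Algebra.Field
import Mathlib.Topology.Instances.Rat
import HarnessLib

/-!
# Frobenioids II, Definition 3.1 (i): proof of the inclusion dichotomy for archimedean local fields

Mochizuki, *The geometry of Frobenioids II*, Kyushu J. Math. **62** (2008) 401–460, §3 Definition 3.1
(i), author's text p. 23 [cite: MochizukiFrdII2008, Def 3.1 (i) p.23]: "If `K`, `L` are archimedean
local fields, then any inclusion of topological rings `ι : K ↪ L` is either an isomorphism or
satisfies the property that there exist isomorphisms of topological fields `α_K : K ≃ ℝ`,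
`α_L : L ≃ ℂ` such that `α_L ∘ ι ∘ α_K⁻¹ : ℝ ↪ ℂ` is the natural inclusion."  The statement file
`Literature.AlgebraicGeometry.Frobenioids.ArchimedeanData` records this sentence as the named fact
`ArchFrd.InclusionDichotomy`; this proof-only companion discharges it (`inclusionDichotomy_holds`).

Proof: transport `ι` to a continuous ring homomorphism between `ℝ`/`ℂ` and `ℝ`/`ℂ`; `ℝ → ℝ` is the
identity (`ℝ` has no nontrivial ring endomorphisms), `ℂ → ℝ` does not exist (`i² = -1`), a continuous
`ℝ → ℂ` is the natural inclusion (it is the identity on `ℚ`, which is dense), and a continuous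
`ℂ → ℂ` is the identity or complex conjugation (Mathlib), both of which are homeomorphic
automorphisms.  Proof-only: no definitions.
-/

namespace Literature.AlgebraicGeometry.Frobenioids

namespace ArchFrd

open Function Set Topology

/-- A continuous ring homomorphism `ℝ → ℂ` is the natural inclusion: it agrees with it on the dense
subset `ℚ`. (Step of FrdII Def. 3.1 (i), "the natural inclusion".)
[cite: MochizukiFrdII2008, Def 3.1 (i) p.23] -/
theorem real_to_complex_continuous_ringHom (f : ℝ →+* ℂ) (hf : Continuous f) (x : ℝ) :
    f x = (x : ℂ) := by
  have hdense : Dense (Set.range ((↑) : ℚ → ℝ)) := Rat.isDenseEmbedding_coe_real.dense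
  have heq : Set.EqOn (fun y : ℝ => f y) (fun y : ℝ => (y : ℂ)) (Set.range ((↑) : ℚ → ℝ)) := by
    rintro _ ⟨q, rfl⟩
    change f (q : ℝ) = ((q : ℝ) : ℂ)
    rw [map_ratCast, Complex.ofReal_ratCast]
  have h := Continuous.ext_on hdense hf Complex.continuous_ofReal heq
  exact congrFun h x

/-- There is no ring homomorphism `ℂ → ℝ` (the image of `i` would square to `-1`).
(Step of FrdII Def. 3.1 (i).) [cite: MochizukiFrdII2008, Def 3.1 (i) p.23] -/
theorem complex_to_real_ringHom_false (f : ℂ →+* ℝ) : False := by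
  have h : f Complex.I ^ 2 = -1 := by
    rw [← map_pow, Complex.I_sq, map_neg, map_one]
  nlinarith [sq_nonneg (f Complex.I)]

/-- **Definition 3.1 (i)** (FrdII p. 23), PROVED: the inclusion dichotomy for archimedean local fields
— a continuous field homomorphism between archimedean local fields is a (bicontinuous) isomorphism,
unless the source is real and the target complex, in which case it is conjugate to the natural
inclusion `ℝ ↪ ℂ`. [cite: MochizukiFrdII2008, Def 3.1 (i) p.23] -/
theorem inclusionDichotomy_holds : InclusionDichotomy := by
  intro K L _ _ _ _ hK hL ι hι
  rcases hL with ⟨⟨eL, heL, heL'⟩⟩ | ⟨⟨eL, heL, heL'⟩⟩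
  · -- `L ≅ ℝ`
    rcases hK with ⟨⟨eK, heK, heK'⟩⟩ | ⟨⟨eK, heK, heK'⟩⟩
    · -- `K ≅ ℝ`: the transported map `ℝ → ℝ` is the identity
      left
      let f : ℝ →+* ℝ := (eL.toRingHom.comp ι).comp eK.symm.toRingHom
      have hf : ∀ x : K, eL (ι x) = eK x := fun x => by
        have h := congrArg (fun g : ℝ →+* ℝ => g (eK x)) (real_ringHom_eq_id f)
        change eL (ι (eK.symm (eK x))) = eK x at h
        rwa [RingEquiv.symm_apply_apply] at h
      refine ⟨eK.trans eL.symm, ?_, ?_, fun x => ?_⟩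
      · exact heL'.comp heK
      · exact heK'.comp heL
      · change eL.symm (eK x) = ι x
        rw [← hf, RingEquiv.symm_apply_apply]
    · -- `K ≅ ℂ`: there is no ring homomorphism `ℂ → ℝ`
      exact (complex_to_real_ringHom_false ((eL.toRingHom.comp ι).comp eK.symm.toRingHom)).elim
  · -- `L ≅ ℂ`
    rcases hK with ⟨⟨eK, heK, heK'⟩⟩ | ⟨⟨eK, heK, heK'⟩⟩
    · -- `K ≅ ℝ`: the transported continuous map `ℝ → ℂ` is the natural inclusion
      right
      refine ⟨eK, eL, heK, heK', heL, heL', fun x => ?_⟩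
      let f : ℝ →+* ℂ := (eL.toRingHom.comp ι).comp eK.symm.toRingHom
      have hfc : Continuous f := heL.comp (hι.comp heK')
      exact real_to_complex_continuous_ringHom f hfc x
    · -- `K ≅ ℂ`: the transported continuous map `ℂ → ℂ` is the identity or conjugation
      left
      let f : ℂ →+* ℂ := (eL.toRingHom.comp ι).comp eK.symm.toRingHom
      have hfc : Continuous f := heL.comp (hι.comp heK')
      have hf : ∀ x : K, eL (ι x) = f (eK x) := fun x => by
        change eL (ι x) = eL (ι (eK.symm (eK x)))
        rw [RingEquiv.symm_apply_apply]
      rcases complex_continuous_ringHom f hfc with h | h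
      · refine ⟨eK.trans eL.symm, heL'.comp heK, heK'.comp heL, fun x => ?_⟩
        change eL.symm (eK x) = ι x
        rw [← RingEquiv.symm_apply_apply eL (ι x), hf x, h, RingHom.id_apply]
      · refine ⟨(eK.trans (starRingAut : ℂ ≃+* ℂ)).trans eL.symm, ?_, ?_, fun x => ?_⟩
        · exact heL'.comp (Complex.continuous_conj.comp heK)
        · change Continuous fun y => eK.symm (starRingAut.symm (eL y))
          exact heK'.comp (Complex.continuous_conj.comp heL)
        · change eL.symm (starRingAut (eK x)) = ι x
          rw [← RingEquiv.symm_apply_apply eL (ι x), hf x, h, starRingAut_apply]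
          rfl

end ArchFrd

end Literature.AlgebraicGeometry.Frobenioids
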